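import Summits.ValiantsHypothesis.ValiantsHypothesis.Theorems.DefinabilityGapRound
import HarnessLib

/-!
# Definability gap, ROAD P: TWO RE-PICK ROUNDS END THE ALTERATION (PLAN (d) v3, deterministic)

`DefinabilityGapRound.round_advance` is iterated twice from a round-one state
(`K₁ = O(m)` movers, every mover with `≥ n₁` unblocked admissible rows): the first re-pick
(`p₂ ≈ 1/n₁`, output `< K₂ = O(1)` movers) and the second (`p₃ ≈ 1/n₂`, output `< 1` mover,
i.e. none) give **`two_repicks`**: an admissible assignment off the Phase-A bad set with the
accumulated thresholds `(t + τ₂ + τ₃, B − β₂ − β₃)` and NO movers — hence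
(`free_of_movers_eq_empty`, `injective_of_movers_eq_empty`) the pivot column `s₀` is free for
every curve and the pivots are injective: exactly the (ALT) clause of the lens schedule.
Also: `phaseABad` is monotone in `(t, B)` (`phaseABad_mono`), so the final thresholds may be
replaced by any schedule values `t' ≥ t_final`, `B' ≤ B_final`.  What remains for `K1Clause 1`
after this file is NUMERICS ONLY: the two `hsmall` budgets and the threshold arithmetic for the
concrete parameters (`DefinabilityGapRoundOneAll` supplies the round-one state).
-/

namespace Summit.ValiantsHypothesis.ValiantsHypothesis.Theorems.DefinabilityGapTwoRepicks

open Finset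
open Literature.Computability.AlgebraicComplexity Literature.Computability.MetaComplexity
open Summit.ValiantsHypothesis.ValiantsHypothesis.Theorems.DefinabilityGapAffineRung
open Summit.ValiantsHypothesis.ValiantsHypothesis.Theorems.DefinabilityGapPivotCertificate
open Summit.ValiantsHypothesis.ValiantsHypothesis.Theorems.DefinabilityGapPivotAdmissible
open Summit.ValiantsHypothesis.ValiantsHypothesis.Theorems.DefinabilityGapPivotRandom
open Summit.ValiantsHypothesis.ValiantsHypothesis.Theorems.DefinabilityGapPivotGoodLines
open Summit.ValiantsHypothesis.ValiantsHypothesis.Theorems.DefinabilityGapPivotCrowded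
open Summit.ValiantsHypothesis.ValiantsHypothesis.Theorems.DefinabilityGapCrowdedFree
open Summit.ValiantsHypothesis.ValiantsHypothesis.Theorems.DefinabilityGapPivotColumn
open Summit.ValiantsHypothesis.ValiantsHypothesis.Theorems.DefinabilityGapPhaseABad
open Summit.ValiantsHypothesis.ValiantsHypothesis.Theorems.DefinabilityGapMovers
open Summit.ValiantsHypothesis.ValiantsHypothesis.Theorems.DefinabilityGapAlterationStep
open Summit.ValiantsHypothesis.ValiantsHypothesis.Theorems.DefinabilityGapRounds
open Summit.ValiantsHypothesis.ValiantsHypothesis.Theorems.DefinabilityGapRepick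
open Summit.ValiantsHypothesis.ValiantsHypothesis.Theorems.DefinabilityGapRound

variable {m : ℕ}

/-! ## 1. Monotonicity of the Phase-A bad set in its thresholds -/

open scoped Classical in
/-- `phaseABad` shrinks when the load threshold `t` grows and the free-position demand `B`
drops. [this file] -/
theorem phaseABad_mono (T : Finset (Fin 3 → Fin (qOf m))) (M N n₀ : ℕ) (p : ℝ) {t t' B B' : ℝ}
    (ht : t ≤ t') (hB : B' ≤ B) : phaseABad T M N n₀ p t' B' ⊆ phaseABad T M N n₀ p t B := by
  intro r hr
  unfold phaseABad at hr ⊢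
  simp only [Finset.mem_union, Finset.mem_filter, Finset.mem_univ, true_and] at hr ⊢
  rcases hr with ((⟨c, hc, i, hi⟩ | ⟨c, hc, j, hj⟩) | ⟨c, hc, i, hi, hi'⟩) | ⟨c, hc, j, hj, hj'⟩
  · exact Or.inl (Or.inl (Or.inl ⟨c, hc, i, by linarith⟩))
  · exact Or.inl (Or.inl (Or.inr ⟨c, hc, j, by linarith⟩))
  · exact Or.inl (Or.inr ⟨c, hc, i, hi, by linarith⟩)
  · exact Or.inr ⟨c, hc, j, hj, by linarith⟩

/-- Contrapositive form used by the schedule. [this file] -/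
theorem not_mem_phaseABad_mono (T : Finset (Fin 3 → Fin (qOf m))) (M N n₀ : ℕ) (p : ℝ)
    {t t' B B' : ℝ} (ht : t ≤ t') (hB : B' ≤ B) {r : (Fin 3 → Fin (qOf m)) → Fin m}
    (hr : r ∉ phaseABad T M N n₀ p t B) : r ∉ phaseABad T M N n₀ p t' B' :=
  fun h => hr (phaseABad_mono T M N n₀ p ht hB h)

/-! ## 2. Two re-pick rounds -/

open scoped Classical in
/-- **TWO RE-PICK ROUNDS END THE ALTERATION** (deterministic in the two failure budgets).
[this file] -/
theorem two_repicks (T : Finset (Fin 3 → Fin (qOf m))) (s₀ : Fin m)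
    (r₁ : (Fin 3 → Fin (qOf m)) → Fin m) (key : (Fin 3 → Fin (qOf m)) → ℕ) (hm : 0 < m)
    {M N n₀ : ℕ} {p₁ t B : ℝ}
    (A : (Fin 3 → Fin (qOf m)) → Finset (Fin m)) (hadm : ∀ c, r₁ c ∈ A c)
    (hr : r₁ ∉ phaseABad T M N n₀ p₁ t B)
    {n₁ : ℝ} (hn₁ : 0 < n₁)
    (hroom : ∀ c ∈ movers T s₀ r₁ key, n₁ ≤ (((A c) \ blockedRows T c r₁ s₀).card : ℝ))
    {K₁ K₂ : ℕ} (hK₁ : (movers T s₀ r₁ key).card ≤ K₁) (hK₂ : 0 < K₂)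
    {p₂ p₃ lam₂ lam₃ t₂ t₃ δ₂ δ₃ : ℝ} (hp₂ : 0 < p₂) (hp₂m : 1 / (m : ℝ) ≤ p₂)
    (hp₂n : 1 / n₁ ≤ p₂) (hlam₂ : 0 < lam₂) (hlam₃ : 0 < lam₃) (ht₂ : 0 < t₂) (ht₃ : 0 < t₃)
    (hδ₂ : 0 < δ₂) (hδ₃ : 0 < δ₃)
    (hn₂ : 0 < n₁ - (p₂ * (2 * K₁ + 1) + lam₂)) (hp₃ : 0 < p₃) (hp₃m : 1 / (m : ℝ) ≤ p₃)
    (hp₃n : 1 / (n₁ - (p₂ * (2 * K₁ + 1) + lam₂)) ≤ p₃)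
    (hsmall₂ : p₂ ^ 2 * (2 * (K₁ : ℝ) * K₁) / K₂ + K₁ * eCol p₂ (2 * K₁ + 1) lam₂ +
      (T.card : ℝ) * m * (eRow p₂ (2 * K₁ + 1) t₂ + eCol p₂ (2 * K₁ + 1) t₂ +
        eRow p₂ (2 * K₁ + 1) δ₂ + eCol p₂ (2 * K₁ + 1) δ₂) < 1)
    (hsmall₃ : p₃ ^ 2 * (2 * (K₂ : ℝ) * K₂) / 1 + K₂ * eCol p₃ (2 * K₂ + 1) lam₃ +
      (T.card : ℝ) * m * (eRow p₃ (2 * K₂ + 1) t₃ + eCol p₃ (2 * K₂ + 1) t₃ +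
        eRow p₃ (2 * K₂ + 1) δ₃ + eCol p₃ (2 * K₂ + 1) δ₃) < 1) :
    ∃ r₃ : (Fin 3 → Fin (qOf m)) → Fin m,
      (∀ c, r₃ c ∈ A c) ∧
      r₃ ∉ phaseABad T M N n₀ p₁ (t + (p₂ * (2 * K₁ + 1) + t₂) + (p₃ * (2 * K₂ + 1) + t₃))
        (B - (p₂ * (2 * K₁ + 1) + δ₂) - (p₃ * (2 * K₂ + 1) + δ₃)) ∧
      movers T s₀ r₃ key = ∅ ∧
      (∀ c ∈ T, s₀ ∈ freeCols T c r₃ (r₃ c)) ∧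
      (∀ c ∈ T, ∀ c' ∈ T, cellEmb m c (r₃ c, s₀) = cellEmb m c' (r₃ c', s₀) → c = c') := by
  have hK₂' : (0 : ℝ) < K₂ := by exact_mod_cast hK₂
  obtain ⟨r₂, hadm₂, hr₂, -, hcard₂, hroom₂, -⟩ :=
    round_advance T s₀ r₁ key hm A hadm hr hn₁ hroom hp₂ hp₂m hp₂n hK₁ hK₂' hlam₂ ht₂ hδ₂
      hsmall₂
  have hK₂le : (movers T s₀ r₂ key).card ≤ K₂ := by
    have : ((movers T s₀ r₂ key).card : ℝ) < K₂ := hcard₂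
    exact_mod_cast this.le
  obtain ⟨r₃, hadm₃, hr₃, -, hcard₃, -, -⟩ :=
    round_advance T s₀ r₂ key hm A hadm₂ hr₂ hn₂ hroom₂ hp₃ hp₃m hp₃n hK₂le one_pos hlam₃
      ht₃ hδ₃ hsmall₃
  have hempty : movers T s₀ r₃ key = ∅ := by
    have h0 : (movers T s₀ r₃ key).card < 1 := by exact_mod_cast hcard₃
    exact Finset.card_eq_zero.mp (by omega)
  exact ⟨r₃, hadm₃, hr₃, hempty, free_of_movers_eq_empty hempty,
    injective_of_movers_eq_empty hempty⟩

/-! ## 3. The number of round-one movers -/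

open scoped Classical in
/-- Movers are collisions: `#movers ≤ collCount`. [this file] -/
theorem card_movers_le_collCount (T : Finset (Fin 3 → Fin (qOf m))) (s₀ : Fin m)
    (r : (Fin 3 → Fin (qOf m)) → Fin m) (key : (Fin 3 → Fin (qOf m)) → ℕ) :
    (movers T s₀ r key).card ≤ collCount T s₀ r :=
  (Finset.card_le_card (movers_subset_notFree T s₀ r key)).trans
    (card_notFree_le_collCount T s₀ r)

end Summit.ValiantsHypothesis.ValiantsHypothesis.Theorems.DefinabilityGapTwoRepicks
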